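import Literature.Computability.AlgebraicComplexity.DDS21GradedFractionsEps
import HarnessLib

/-!
# Dutta–Dwivedi–Saxena 2021, §3: `lim_{ε→0}` versus the `x`-grading for exact fractions
# (the honest core of "`(g_j/T̃)|_{z=0}`, then `ε → 0`")

Topic `Literature/Computability/AlgebraicComplexity` (cell `val-lit`, row X2-DDS21, brick "B4c (E4)"
of the `DDS2021_thm_3_2` programme; frame RULING (132)(a): R0 graded `x`-frame, R1 exact objects,
R2 genericity). Source: P. Dutta, P. Dwivedi, N. Saxena, *Demystifying the border of depth-3
algebraic circuits*, FOCS 2021 [DuttaDwivediSaxena2022], held full version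
`paper:galaxy-pdf-7641649743695546420` (chunk `pNNNN.txt`, printed line `Lnnn`).

The printed proof evaluates DiDIL objects at `z = 0` and lets `ε → 0`, in either order:
"`(Φ(f₀)/T̃_{k,0})|_{ε=0} = Φ(f₀)/t_{k,0} ∈ F(x)[[z]]`" (Claim 3.4, p0029 L777–779) and
"`g_j/T̃_{k-j,j} ∈ F(x,ε)[[z]]` … the valuation with respect to `z` and `ε` is non-negative …
`f_j/t_{k-j,j}|_{z=0} = lim_{ε→0} (g_j/T̃_{k-j,j})|_{z=0}`" (Claim 3.8, p0035 L934–941). In the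
graded `x`-frame "`|_{z=0}`" of an object of nonnegative `z`-order is its DEGREE-ZERO GRADED VALUE
(`DDS2021.GradeZero` below: for `Y = P/Q` with `P` vanishing below `ldeg Q`,
`[Y]_0 = [P]_{ldeg Q} / in(Q)`), and "`lim_{ε→0}`" is `DDS2021.EpsLim`
(`DDS21EpsIntegralFractions.lean`). This file proves WHEN the two commute — exactly under the
invariant "the denominator model has an `ε`-UNIT INITIAL FORM" (memo F4/F5 of
`HOME/np/MEMO-t21g12-DDS21-B4-DiDIL.md`, NOTE-t21g13 (I2)): for a generic pre-shift `α` it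
holds at every stage, for special `α` it fails (F4's CAS examples), which is why the printed
"valuation … non-negative" needs the random `α` beyond `T_{i,0}(α) ≠ 0`.

## Contents (definitions with bodies + proved API; no named facts)

* (G1) GAUSS LEMMA for `ε`-integral POLYNOMIALS (`EpsLim.exists_integralModel`): if
  `g ∈ F(ε)[x]`, read in `F(ε)(x)`, is `ε`-integral, then `q(ε)·g = Ĝ` with `q(0) ≠ 0`,
  `Ĝ ∈ F[ε][x]` (so `g` has no pole at `ε = 0` coefficientwise); hence limits of polynomials are
  polynomials (`EpsLim.exists_eq_limToFrac`), homogeneous components commute with `lim`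
  (`EpsLim.homogeneousComponent`), and an `ε`-integral `Y` with `Y·E` a polynomial for an
  integral `E` has an INTEGRAL model with denominator `q·E` (`EpsLim.exists_model_of_mul_intToFrac`).
* (G2) `ldeg`/`initialForm` (p1's `DDS21GradedFractions.lean`) under coefficient maps:
  `ldeg_le_ldeg_map` (with p1's `homogeneousComponent_map'`), `ldeg_map_of_injective`,
  `initialForm_map_of_injective`, and — the unit-initial-form case — `ldeg_map_eq_of_ne_zero`,
  `initialForm_map_eq_of_ne_zero` (if `f(in P) ≠ 0` then `ldeg (map f P) = ldeg P` and
  `in(map f P) = f(in P)`; used with `f = (ε ↦ 0)`).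
* (G3) `DDS2021.GradeZero Y w` on `Frac(K[x])` ("`Y|_{z=0} = w`" for `Y` of nonnegative order):
  well-definedness `GradeZero.unique` (via `[P Q']_{λ+λ'} = [P]_λ · in(Q')`), constructors
  `gradeZero_of_model`, `gradeZero_algebraMap` (`p ↦ p(0)`), `gradeZero_div_of_coeff_zero_ne`
  (`p/Q ↦ p(0)/Q(0)` when `Q(0) ≠ 0`), `gradeZero_div_initialForm` (order `0`: `in P / in Q`),
  `gradeZero_div_eq_zero` (positive order), and the calculus `GradeZero.add/mul/neg/sub/sum/smul`
  ("`(Σ_i T_i/T̃)|_{z=0} = Σ_i (T_i/T̃)|_{z=0}`", p0035 L936–939).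
* (G4) ★ `EpsLim.gradeZero_of_model`: if `Y = M/E` with `M, E ∈ F[ε][x]`, `M` vanishing below
  `ldeg E` and `red(in E) ≠ 0`, then `lim (Y|_{z=0}) = (lim Y)|_{z=0}` — i.e.
  `EpsLim Y r → GradeZero Y w → GradeZero r w₀ → EpsLim w w₀`, with the explicit values
  `w = [M]_λ/in(E)`, `w₀ = [red M]_λ/in(red E)`.

What is NOT here: which DiDIL objects satisfy the hypothesis of (G4) (that is the content of the
genericity statement of NOTE-t21g13 §2, assembled in B4c from `DirectionalShift.lean` and B4b's
`ExactTerm` models), and the `Σ∧Σ`/ABP conversion of `w_j` (t19's `border_div_swsClass`, t24's ABPs).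

Honest framing: Gauss-lemma and grading bookkeeping; nothing here bears on VP versus VNP, which
is NOT proved; `DDS2021_thm_3_2` and `DDS2021_thm_5_1` remain named facts.

## References

* [DuttaDwivediSaxena2022] P. Dutta, P. Dwivedi, N. Saxena, *Demystifying the border of depth-3
  algebraic circuits*, Proc. 62nd FOCS (2021), IEEE 2022, 92–103; full version
  `paper:galaxy-pdf-7641649743695546420`: §2 "Valuation" p0015 L407–410, Claim 3.3 proof p0027
  L726–737, Claim 3.4 proof p0029 L772–785, induction hypotheses p0030 L799–812, Claim 3.8
  p0035 L934–941.
-/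

noncomputable section

open MvPolynomial
open scoped BigOperators Polynomial

namespace Literature.Computability.AlgebraicComplexity

namespace DDS2021

/-! ### (G2) Lowest degree and initial form under a change of coefficients -/

section MapLemmas

variable {σ : Type*} {R S : Type*} [CommSemiring R] [CommSemiring S]

/-- A nonzero polynomial has a nonzero coefficient in its lowest degree.
[cite: DuttaDwivediSaxena2022, §3 induction hypotheses (1)–(3) (full version p0030 L799–805)] -/
theorem exists_coeff_ne_zero_degree_eq_ldeg {p : MvPolynomial σ R} (hp : p ≠ 0) :
    ∃ d : σ →₀ ℕ, d.degree = ldeg p ∧ coeff d p ≠ 0 := by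
  obtain ⟨d, hd⟩ := MvPolynomial.exists_coeff_ne_zero (initialForm_ne_zero hp)
  rw [initialForm, coeff_homogeneousComponent] at hd
  by_cases h : d.degree = ldeg p
  · rw [if_pos h] at hd
    exact ⟨d, h, hd⟩
  · rw [if_neg h] at hd
    exact absurd rfl hd

/-- Vanishing of all coefficients below degree `n` forces `n ≤ ldeg`.
[cite: DuttaDwivediSaxena2022, §3 induction hypotheses (1)–(3) (full version p0030 L799–805)] -/
theorem le_ldeg_of_coeff_eq_zero {p : MvPolynomial σ R} (hp : p ≠ 0) {n : ℕ}
    (h : ∀ d : σ →₀ ℕ, d.degree < n → coeff d p = 0) : n ≤ ldeg p := by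
  obtain ⟨d, hd, hdp⟩ := exists_coeff_ne_zero_degree_eq_ldeg hp
  by_contra hlt
  exact hdp (h d (by rw [hd]; exact not_le.mp hlt))

/-- Coefficient maps can only raise the lowest degree.
[cite: DuttaDwivediSaxena2022, Claim 3.3 proof (full version p0027 L729–735)] -/
theorem ldeg_le_ldeg_map (f : R →+* S) {p : MvPolynomial σ R} (h : map f p ≠ 0) :
    ldeg p ≤ ldeg (map f p) :=
  le_ldeg_of_coeff_eq_zero h fun d hd => by
    rw [coeff_map, coeff_eq_zero_of_degree_lt_ldeg hd, map_zero]

/-- **Unit initial form, lowest degree**: if the initial form survives the coefficient map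
(`f(in p) ≠ 0`, e.g. "`in(T̃)` is an `ε`-unit" for `f = (ε ↦ 0)`), the lowest degree is unchanged.
[cite: DuttaDwivediSaxena2022, §3 DIVIDE step and Claim 3.4 proof (full version p0030 L808–810, p0029 L777–779)] -/
theorem ldeg_map_eq_of_ne_zero (f : R →+* S) {p : MvPolynomial σ R}
    (h : map f (initialForm p) ≠ 0) : ldeg (map f p) = ldeg p := by
  have hmp : map f p ≠ 0 := by
    intro h0
    apply h
    rw [initialForm, ← homogeneousComponent_map', h0, map_zero]
  refine le_antisymm ?_ (ldeg_le_ldeg_map f hmp)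
  obtain ⟨d, hd⟩ := MvPolynomial.exists_coeff_ne_zero h
  rw [initialForm, ← homogeneousComponent_map', coeff_homogeneousComponent] at hd
  by_cases hdeg : d.degree = ldeg p
  · rw [if_pos hdeg] at hd
    exact hdeg ▸ ldeg_le_of_coeff_ne_zero hd
  · rw [if_neg hdeg] at hd
    exact absurd rfl hd

/-- **Unit initial form, initial form**: if `f(in p) ≠ 0` then `in(map f p) = f(in p)`
(reduction modulo `ε` commutes with taking initial forms when the initial form is an `ε`-unit).
[cite: DuttaDwivediSaxena2022, Claim 3.4 proof "(Φ(f₀)/T̃)|_{ε=0} = Φ(f₀)/t" (full version p0029 L777–779)] -/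
theorem initialForm_map_eq_of_ne_zero (f : R →+* S) {p : MvPolynomial σ R}
    (h : map f (initialForm p) ≠ 0) : initialForm (map f p) = map f (initialForm p) := by
  rw [initialForm, ldeg_map_eq_of_ne_zero f h, homogeneousComponent_map', initialForm]

/-- Injective coefficient maps preserve the lowest degree.
[cite: DuttaDwivediSaxena2022, §2 "Valuation" (full version p0015 L407–410)] -/
theorem ldeg_map_of_injective {f : R →+* S} (hf : Function.Injective f) (p : MvPolynomial σ R) :
    ldeg (map f p) = ldeg p := by
  by_cases hp : p = 0
  · rw [hp, map_zero, ldeg_zero, ldeg_zero]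
  · apply ldeg_map_eq_of_ne_zero
    rw [Ne, map_eq_zero_iff _ (map_injective f hf)]
    exact initialForm_ne_zero hp

/-- Injective coefficient maps preserve the initial form.
[cite: DuttaDwivediSaxena2022, §2 "Valuation" (full version p0015 L407–410)] -/
theorem initialForm_map_of_injective {f : R →+* S} (hf : Function.Injective f)
    (p : MvPolynomial σ R) : initialForm (map f p) = map f (initialForm p) := by
  rw [initialForm, ldeg_map_of_injective hf, homogeneousComponent_map', initialForm]

/-- Vanishing below a degree is inherited by coefficient maps.
[cite: DuttaDwivediSaxena2022, Claim 3.4 proof (full version p0029 L772–776)] -/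
theorem coeff_map_eq_zero_of_lt (f : R →+* S) {p : MvPolynomial σ R} {n : ℕ}
    (h : ∀ d : σ →₀ ℕ, d.degree < n → coeff d p = 0) (d : σ →₀ ℕ) (hd : d.degree < n) :
    coeff d (map f p) = 0 := by
  rw [coeff_map, h d hd, map_zero]

end MapLemmas

/-! ### Products of polynomials vanishing below given degrees -/

section Vanishing

variable {σ : Type*} {K : Type*} [CommSemiring K]

/-- **Lowest pieces multiply**: if `P` vanishes below degree `m` and `Q` below degree `n`, the
degree-`(m+n)` component of `P·Q` is `[P]_m · [Q]_n` (Mathlib's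
`MvPowerSeries.homogeneousComponent_mul_of_le_order`, read on polynomials).
[cite: DuttaDwivediSaxena2022, Claim 3.8 proof (full version p0035 L936–939)] -/
theorem homogeneousComponent_mul_of_vanishing {P Q : MvPolynomial σ K} {m n : ℕ}
    (hP : ∀ d : σ →₀ ℕ, d.degree < m → coeff d P = 0)
    (hQ : ∀ d : σ →₀ ℕ, d.degree < n → coeff d Q = 0) :
    homogeneousComponent (m + n) (P * Q) = homogeneousComponent m P * homogeneousComponent n Q := by
  apply MvPolynomial.coe_injective
  rw [MvPolynomial.coe_mul, coe_homogeneousComponent, coe_homogeneousComponent,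
    coe_homogeneousComponent, MvPolynomial.coe_mul]
  apply MvPowerSeries.homogeneousComponent_mul_of_le_order
  · exact MvPowerSeries.nat_le_order fun d hd => by rw [MvPolynomial.coeff_coe]; exact hP d hd
  · exact MvPowerSeries.nat_le_order fun d hd => by rw [MvPolynomial.coeff_coe]; exact hQ d hd

/-- Products vanish below the sum of the vanishing degrees.
[cite: DuttaDwivediSaxena2022, Claim 3.8 proof (full version p0035 L936–939)] -/
theorem coeff_mul_eq_zero_of_vanishing {P Q : MvPolynomial σ K} {m n : ℕ}
    (hP : ∀ d : σ →₀ ℕ, d.degree < m → coeff d P = 0)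
    (hQ : ∀ d : σ →₀ ℕ, d.degree < n → coeff d Q = 0) (d : σ →₀ ℕ) (hd : d.degree < m + n) :
    coeff d (P * Q) = 0 := by
  rw [← MvPolynomial.coeff_coe, MvPolynomial.coe_mul]
  apply MvPowerSeries.coeff_of_lt_order
  refine lt_of_lt_of_le ?_ MvPowerSeries.le_order_mul
  have h1 : (m : ℕ∞) ≤ (P : MvPowerSeries σ K).order :=
    MvPowerSeries.nat_le_order fun d hd => by rw [MvPolynomial.coeff_coe]; exact hP d hd
  have h2 : (n : ℕ∞) ≤ (Q : MvPowerSeries σ K).order :=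
    MvPowerSeries.nat_le_order fun d hd => by rw [MvPolynomial.coeff_coe]; exact hQ d hd
  calc (d.degree : ℕ∞) < (m + n : ℕ) := by exact_mod_cast hd
    _ = (m : ℕ∞) + n := by push_cast; rfl
    _ ≤ _ := add_le_add h1 h2

/-- A nonzero polynomial vanishes below its lowest degree (restating p1's
`coeff_eq_zero_of_degree_lt_ldeg` in the "vanishing below `n`" currency of this file).
[cite: DuttaDwivediSaxena2022, §3 induction hypotheses (1)–(3) (full version p0030 L799–805)] -/
theorem vanishing_ldeg (Q : MvPolynomial σ K) :
    ∀ d : σ →₀ ℕ, d.degree < ldeg Q → coeff d Q = 0 :=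
  fun _ hd => coeff_eq_zero_of_degree_lt_ldeg hd

end Vanishing

/-! ### (G3) The degree-zero graded value `Y|_{z=0}` of a fraction of nonnegative order -/

section GradeZero

variable {σ : Type*} {K : Type*} [Field K]

/-- **`Y|_{z=0} = w`** for `Y ∈ K(x) = Frac(K[x])` of nonnegative graded order: `Y = P/Q` with
`Q ≠ 0`, `P` vanishing below `λ := ldeg Q`, and `w = [P]_λ / in(Q)` (a degree-`0` homogeneous
rational function). This is the graded reading of DDS's "`·|_{z=0}`" applied to
`Φ(T)/T̃`, `g_j/T̃_{k-j,j}`, `f_j/t_{k-j,j}` (objects of `F(x,ε)[[z]]`, i.e. of `val_z ≥ 0`).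
[cite: DuttaDwivediSaxena2022, Claim 3.8 (full version p0035 L934–941); Claim 3.4 proof (p0029 L777–779)] -/
def GradeZero (Y w : FractionRing (MvPolynomial σ K)) : Prop :=
  ∃ P Q : MvPolynomial σ K, Q ≠ 0 ∧
    Y * algebraMap (MvPolynomial σ K) (FractionRing (MvPolynomial σ K)) Q =
      algebraMap (MvPolynomial σ K) (FractionRing (MvPolynomial σ K)) P ∧
    (∀ d : σ →₀ ℕ, d.degree < ldeg Q → coeff d P = 0) ∧
    w * algebraMap (MvPolynomial σ K) (FractionRing (MvPolynomial σ K)) (initialForm Q) =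
      algebraMap (MvPolynomial σ K) (FractionRing (MvPolynomial σ K))
        (homogeneousComponent (ldeg Q) P)

/-- `K[x] → K(x)` is injective. (folklore) [cite: DuttaDwivediSaxena2022, §2 "Valuation" (full version p0015 L407–410)] -/
theorem algebraMap_frac_injective :
    Function.Injective (algebraMap (MvPolynomial σ K) (FractionRing (MvPolynomial σ K))) :=
  IsFractionRing.injective _ _

/-- Nonzero polynomials are nonzero in `K(x)`. (folklore) [cite: DuttaDwivediSaxena2022, §2 "Valuation" (full version p0015 L407–410)] -/
theorem algebraMap_frac_ne_zero {p : MvPolynomial σ K} (hp : p ≠ 0) :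
    algebraMap (MvPolynomial σ K) (FractionRing (MvPolynomial σ K)) p ≠ 0 :=
  fun h => hp (algebraMap_frac_injective (by rw [h, map_zero]))

/-- **Any presentation computes `Y|_{z=0}`**: `Y = P/Q`, `P` vanishing below `ldeg Q`.
[cite: DuttaDwivediSaxena2022, Claim 3.8 proof (full version p0035 L934–939)] -/
theorem gradeZero_of_model {Y : FractionRing (MvPolynomial σ K)} {P Q : MvPolynomial σ K}
    (hQ : Q ≠ 0)
    (hY : Y * algebraMap (MvPolynomial σ K) (FractionRing (MvPolynomial σ K)) Q =
      algebraMap (MvPolynomial σ K) (FractionRing (MvPolynomial σ K)) P)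
    (hP : ∀ d : σ →₀ ℕ, d.degree < ldeg Q → coeff d P = 0) :
    GradeZero Y
      (algebraMap (MvPolynomial σ K) (FractionRing (MvPolynomial σ K))
          (homogeneousComponent (ldeg Q) P) /
        algebraMap (MvPolynomial σ K) (FractionRing (MvPolynomial σ K)) (initialForm Q)) :=
  ⟨P, Q, hQ, hY, hP, div_mul_cancel₀ _ (algebraMap_frac_ne_zero (initialForm_ne_zero hQ))⟩

/-- The cross-multiplication identity behind well-definedness: two presentations `P/Q = P'/Q'`
with `P` (`P'`) vanishing below `ldeg Q` (`ldeg Q'`) satisfy `[P]_λ · in(Q') = [P']_{λ'} · in(Q)`.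
[cite: DuttaDwivediSaxena2022, Claim 3.8 proof (full version p0035 L936–939)] -/
theorem homogeneousComponent_mul_initialForm_eq {P Q P' Q' : MvPolynomial σ K}
    (h : P * Q' = P' * Q)
    (hP : ∀ d : σ →₀ ℕ, d.degree < ldeg Q → coeff d P = 0)
    (hP' : ∀ d : σ →₀ ℕ, d.degree < ldeg Q' → coeff d P' = 0) :
    homogeneousComponent (ldeg Q) P * initialForm Q' =
      homogeneousComponent (ldeg Q') P' * initialForm Q := by
  have h1 := homogeneousComponent_mul_of_vanishing hP (vanishing_ldeg Q')
  have h2 := homogeneousComponent_mul_of_vanishing hP' (vanishing_ldeg Q)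
  rw [initialForm, initialForm, ← h1, ← h2, h, add_comm]

variable {Y Y₁ Y₂ w w' w₁ w₂ : FractionRing (MvPolynomial σ K)}

/-- **`Y|_{z=0}` is well defined.** [cite: DuttaDwivediSaxena2022, Claim 3.8 proof (full version p0035 L934–939)] -/
theorem GradeZero.unique (h : GradeZero Y w) (h' : GradeZero Y w') : w = w' := by
  obtain ⟨P, Q, hQ, hY, hP, hw⟩ := h
  obtain ⟨P', Q', hQ', hY', hP', hw'⟩ := h'
  have hx : P * Q' = P' * Q := by
    apply algebraMap_frac_injective
    rw [map_mul, map_mul, ← hY, ← hY']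
    ring
  have key := homogeneousComponent_mul_initialForm_eq hx hP hP'
  have hne : algebraMap (MvPolynomial σ K) (FractionRing (MvPolynomial σ K)) (initialForm Q) *
      algebraMap (MvPolynomial σ K) (FractionRing (MvPolynomial σ K)) (initialForm Q') ≠ 0 :=
    mul_ne_zero (algebraMap_frac_ne_zero (initialForm_ne_zero hQ))
      (algebraMap_frac_ne_zero (initialForm_ne_zero hQ'))
  apply mul_right_cancel₀ hne
  calc w * (algebraMap _ _ (initialForm Q) * algebraMap _ _ (initialForm Q'))
      = (w * algebraMap _ _ (initialForm Q)) * algebraMap _ _ (initialForm Q') := by ring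
    _ = algebraMap _ (FractionRing (MvPolynomial σ K))
          (homogeneousComponent (ldeg Q) P * initialForm Q') := by rw [hw, map_mul]
    _ = algebraMap _ (FractionRing (MvPolynomial σ K))
          (homogeneousComponent (ldeg Q') P' * initialForm Q) := by rw [key]
    _ = (w' * algebraMap _ _ (initialForm Q')) * algebraMap _ _ (initialForm Q) := by
          rw [map_mul, hw']
    _ = w' * (algebraMap _ _ (initialForm Q) * algebraMap _ _ (initialForm Q')) := by ring

/-- Any presentation computes the value, equational form.
[cite: DuttaDwivediSaxena2022, Claim 3.8 proof (full version p0035 L934–939)] -/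
theorem GradeZero.mul_eq_of_model (h : GradeZero Y w) {P Q : MvPolynomial σ K} (hQ : Q ≠ 0)
    (hY : Y * algebraMap (MvPolynomial σ K) (FractionRing (MvPolynomial σ K)) Q =
      algebraMap (MvPolynomial σ K) (FractionRing (MvPolynomial σ K)) P)
    (hP : ∀ d : σ →₀ ℕ, d.degree < ldeg Q → coeff d P = 0) :
    w * algebraMap (MvPolynomial σ K) (FractionRing (MvPolynomial σ K)) (initialForm Q) =
      algebraMap (MvPolynomial σ K) (FractionRing (MvPolynomial σ K))
        (homogeneousComponent (ldeg Q) P) := by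
  rw [h.unique (gradeZero_of_model hQ hY hP),
    div_mul_cancel₀ _ (algebraMap_frac_ne_zero (initialForm_ne_zero hQ))]

/-- `ldeg 1 = 0`. [cite: DuttaDwivediSaxena2022, §3 induction hypotheses (1)–(3) (full version p0030 L799–805)] -/
theorem ldeg_one' : ldeg (1 : MvPolynomial σ K) = 0 := by
  rw [← C_1, ldeg_C]

/-- `in(C a) = C a`. [cite: DuttaDwivediSaxena2022, §3 induction hypotheses (1)–(3) (full version p0030 L799–805)] -/
theorem initialForm_C' (a : K) : initialForm (C a : MvPolynomial σ K) = C a := by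
  rw [initialForm, ldeg_C, homogeneousComponent_zero, coeff_zero_C]

/-- `in(1) = 1`. [cite: DuttaDwivediSaxena2022, §3 induction hypotheses (1)–(3) (full version p0030 L799–805)] -/
theorem initialForm_one' : initialForm (1 : MvPolynomial σ K) = 1 := by
  rw [← C_1, initialForm_C']

/-- **Polynomials**: `p|_{z=0} = p(0)` (the constant term).
[cite: DuttaDwivediSaxena2022, §3 induction hypothesis (3) "U_{i,j}|_{z=0} ∈ F(ε)∖{0}" (full version p0030 L804–805)] -/
theorem gradeZero_algebraMap (p : MvPolynomial σ K) :
    GradeZero (algebraMap (MvPolynomial σ K) (FractionRing (MvPolynomial σ K)) p)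
      (algebraMap (MvPolynomial σ K) (FractionRing (MvPolynomial σ K)) (C (coeff 0 p))) := by
  refine ⟨p, 1, one_ne_zero, by rw [map_one, mul_one], fun d hd => ?_, ?_⟩
  · rw [ldeg_one'] at hd
    exact absurd hd (Nat.not_lt_zero _)
  · rw [initialForm_one', ldeg_one', homogeneousComponent_zero, map_one, mul_one]

/-- `0|_{z=0} = 0`. [cite: DuttaDwivediSaxena2022, Claim 3.8 proof (full version p0035 L934–939)] -/
theorem gradeZero_zero : GradeZero (0 : FractionRing (MvPolynomial σ K)) 0 := by
  have h := gradeZero_algebraMap (0 : MvPolynomial σ K)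
  rwa [map_zero, coeff_zero, C_0, map_zero] at h

/-- **Quotients by a unit of the grading**: `(p/Q)|_{z=0} = p(0)/Q(0)` when `Q(0) ≠ 0` (the
`ΠΣ`-part: "`U|_{z=0}, V|_{z=0} ∈ F(ε)∖{0}`").
[cite: DuttaDwivediSaxena2022, §3 induction hypothesis (3) (full version p0030 L804–805)] -/
theorem gradeZero_div_of_coeff_zero_ne (p : MvPolynomial σ K) {Q : MvPolynomial σ K}
    (hQ : coeff 0 Q ≠ 0) :
    GradeZero (algebraMap (MvPolynomial σ K) (FractionRing (MvPolynomial σ K)) p /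
        algebraMap (MvPolynomial σ K) (FractionRing (MvPolynomial σ K)) Q)
      (algebraMap (MvPolynomial σ K) (FractionRing (MvPolynomial σ K)) (C (coeff 0 p)) /
        algebraMap (MvPolynomial σ K) (FractionRing (MvPolynomial σ K)) (C (coeff 0 Q))) := by
  have hQ0 : Q ≠ 0 := fun h => hQ (by rw [h, coeff_zero])
  have hl : ldeg Q = 0 := (ldeg_eq_zero_iff hQ0).mpr hQ
  have h := gradeZero_of_model (Y := algebraMap _ (FractionRing (MvPolynomial σ K)) p /
      algebraMap _ (FractionRing (MvPolynomial σ K)) Q) hQ0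
    (div_mul_cancel₀ _ (algebraMap_frac_ne_zero hQ0))
    (fun d hd => absurd hd (by rw [hl]; exact Nat.not_lt_zero _))
  rwa [initialForm, hl, homogeneousComponent_zero, homogeneousComponent_zero] at h

/-- **Order zero**: `(P/Q)|_{z=0} = in(P)/in(Q)` when `ldeg P = ldeg Q` (the generic DiDIL
situation: every term and the divisor have the same `z`-order).
[cite: DuttaDwivediSaxena2022, Claim 3.8 proof (full version p0035 L934–939); Claim 3.4 proof (p0029 L777–779)] -/
theorem gradeZero_div_initialForm {P Q : MvPolynomial σ K} (hQ : Q ≠ 0) (h : ldeg P = ldeg Q) :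
    GradeZero (algebraMap (MvPolynomial σ K) (FractionRing (MvPolynomial σ K)) P /
        algebraMap (MvPolynomial σ K) (FractionRing (MvPolynomial σ K)) Q)
      (algebraMap (MvPolynomial σ K) (FractionRing (MvPolynomial σ K)) (initialForm P) /
        algebraMap (MvPolynomial σ K) (FractionRing (MvPolynomial σ K)) (initialForm Q)) := by
  have hmod := gradeZero_of_model (Y := algebraMap _ (FractionRing (MvPolynomial σ K)) P /
      algebraMap _ (FractionRing (MvPolynomial σ K)) Q) hQ
    (div_mul_cancel₀ _ (algebraMap_frac_ne_zero hQ)) (fun d hd => vanishing_ldeg P d (h ▸ hd))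
  rwa [← h] at hmod

/-- **Positive order**: `(P/Q)|_{z=0} = 0` when `P` vanishes up to and including degree
`ldeg Q`. [cite: DuttaDwivediSaxena2022, Claim 3.4 proof "val_z(…) ≥ v_{k,0}" (full version p0029 L774–776)] -/
theorem gradeZero_div_eq_zero {P Q : MvPolynomial σ K} (hQ : Q ≠ 0)
    (h : ∀ d : σ →₀ ℕ, d.degree ≤ ldeg Q → coeff d P = 0) :
    GradeZero (algebraMap (MvPolynomial σ K) (FractionRing (MvPolynomial σ K)) P /
        algebraMap (MvPolynomial σ K) (FractionRing (MvPolynomial σ K)) Q) 0 := by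
  have hmod := gradeZero_of_model (Y := algebraMap _ (FractionRing (MvPolynomial σ K)) P /
      algebraMap _ (FractionRing (MvPolynomial σ K)) Q) hQ
    (div_mul_cancel₀ _ (algebraMap_frac_ne_zero hQ)) (fun d hd => h d hd.le)
  have h0 : homogeneousComponent (ldeg Q) P = 0 := by
    ext d
    rw [coeff_homogeneousComponent, coeff_zero]
    split_ifs with hd
    · exact h d hd.le
    · rfl
  rwa [h0, map_zero, zero_div] at hmod

/-- Unfolding `initialForm` (for rewriting). [cite: DuttaDwivediSaxena2022, §3 induction hypotheses (1)–(3) (full version p0030 L799–805)] -/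
theorem initialForm_def' (Q : MvPolynomial σ K) : initialForm Q = homogeneousComponent (ldeg Q) Q :=
  rfl

/-- **Additivity**: `(Y₁ + Y₂)|_{z=0} = Y₁|_{z=0} + Y₂|_{z=0}` on fractions of nonnegative order
("`Σ_i (T_{i,j}/T̃)|_{z=0}`"). [cite: DuttaDwivediSaxena2022, Claim 3.8 proof (full version p0035 L936–939)] -/
theorem GradeZero.add (h₁ : GradeZero Y₁ w₁) (h₂ : GradeZero Y₂ w₂) :
    GradeZero (Y₁ + Y₂) (w₁ + w₂) := by
  obtain ⟨P₁, Q₁, hQ₁, hY₁, hP₁, hw₁⟩ := h₁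
  obtain ⟨P₂, Q₂, hQ₂, hY₂, hP₂, hw₂⟩ := h₂
  refine ⟨P₁ * Q₂ + P₂ * Q₁, Q₁ * Q₂, mul_ne_zero hQ₁ hQ₂, ?_, ?_, ?_⟩
  · simp only [map_mul, map_add]
    rw [← hY₁, ← hY₂]
    ring
  · intro d hd
    rw [ldeg_mul hQ₁ hQ₂] at hd
    rw [coeff_add, coeff_mul_eq_zero_of_vanishing hP₁ (vanishing_ldeg Q₂) d hd,
      coeff_mul_eq_zero_of_vanishing hP₂ (vanishing_ldeg Q₁) d (by rwa [add_comm]), add_zero]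
  · rw [initialForm_mul, ldeg_mul hQ₁ hQ₂, map_add (homogeneousComponent _),
      homogeneousComponent_mul_of_vanishing hP₁ (vanishing_ldeg Q₂), add_comm (ldeg Q₁) (ldeg Q₂),
      homogeneousComponent_mul_of_vanishing hP₂ (vanishing_ldeg Q₁), ← initialForm_def',
      ← initialForm_def']
    simp only [map_add, map_mul]
    rw [← hw₁, ← hw₂]
    ring

/-- **Multiplicativity**: `(Y₁ Y₂)|_{z=0} = Y₁|_{z=0} · Y₂|_{z=0}`.
[cite: DuttaDwivediSaxena2022, Claim 3.8 proof (full version p0035 L936–939)] -/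
theorem GradeZero.mul (h₁ : GradeZero Y₁ w₁) (h₂ : GradeZero Y₂ w₂) :
    GradeZero (Y₁ * Y₂) (w₁ * w₂) := by
  obtain ⟨P₁, Q₁, hQ₁, hY₁, hP₁, hw₁⟩ := h₁
  obtain ⟨P₂, Q₂, hQ₂, hY₂, hP₂, hw₂⟩ := h₂
  refine ⟨P₁ * P₂, Q₁ * Q₂, mul_ne_zero hQ₁ hQ₂, ?_, ?_, ?_⟩
  · simp only [map_mul]
    rw [← hY₁, ← hY₂]
    ring
  · intro d hd
    rw [ldeg_mul hQ₁ hQ₂] at hd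
    exact coeff_mul_eq_zero_of_vanishing hP₁ hP₂ d hd
  · rw [initialForm_mul, ldeg_mul hQ₁ hQ₂, homogeneousComponent_mul_of_vanishing hP₁ hP₂]
    simp only [map_mul]
    rw [← hw₁, ← hw₂]
    ring

/-- `(−Y)|_{z=0} = −(Y|_{z=0})`. [cite: DuttaDwivediSaxena2022, Claim 3.8 proof (full version p0035 L936–939)] -/
theorem GradeZero.neg (h : GradeZero Y w) : GradeZero (-Y) (-w) := by
  obtain ⟨P, Q, hQ, hY, hP, hw⟩ := h
  refine ⟨-P, Q, hQ, ?_, fun d hd => by rw [coeff_neg, hP d hd, neg_zero], ?_⟩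
  · rw [map_neg, ← hY, neg_mul]
  · rw [map_neg, map_neg, ← hw, neg_mul]

/-- `(Y₁ − Y₂)|_{z=0} = Y₁|_{z=0} − Y₂|_{z=0}`. [cite: DuttaDwivediSaxena2022, Claim 3.8 proof (full version p0035 L936–939)] -/
theorem GradeZero.sub (h₁ : GradeZero Y₁ w₁) (h₂ : GradeZero Y₂ w₂) :
    GradeZero (Y₁ - Y₂) (w₁ - w₂) := by
  rw [sub_eq_add_neg, sub_eq_add_neg]
  exact h₁.add h₂.neg

/-- Finite sums: `(Σ_i Y_i)|_{z=0} = Σ_i (Y_i|_{z=0})`.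
[cite: DuttaDwivediSaxena2022, Claim 3.8 proof "Σ_{i∈[k−j]} T_{i,j}/T̃" (full version p0035 L936–939)] -/
theorem gradeZero_sum {ι : Type*} (s : Finset ι) {Y w : ι → FractionRing (MvPolynomial σ K)}
    (h : ∀ i ∈ s, GradeZero (Y i) (w i)) : GradeZero (∑ i ∈ s, Y i) (∑ i ∈ s, w i) := by
  classical
  induction s using Finset.induction_on with
  | empty => rw [Finset.sum_empty, Finset.sum_empty]; exact gradeZero_zero
  | insert a s ha ih =>
    rw [Finset.sum_insert ha, Finset.sum_insert ha]
    exact (h a (Finset.mem_insert_self a s)).add (ih fun i hi => h i (Finset.mem_insert_of_mem hi))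

/-- Scalars pass through: `(c·Y)|_{z=0} = c·(Y|_{z=0})` for a constant `c`.
[cite: DuttaDwivediSaxena2022, Claim 3.8 proof (full version p0035 L936–939)] -/
theorem GradeZero.C_mul (h : GradeZero Y w) (c : K) :
    GradeZero (algebraMap (MvPolynomial σ K) (FractionRing (MvPolynomial σ K)) (C c) * Y)
      (algebraMap (MvPolynomial σ K) (FractionRing (MvPolynomial σ K)) (C c) * w) := by
  have hc := gradeZero_algebraMap (σ := σ) (C c)
  rw [coeff_zero_C] at hc
  exact hc.mul h

end GradeZero

/-! ### (G1) The Gauss lemma for `ε`-integral polynomials -/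

section Gauss

variable {F : Type*} [Field F] {σ : Type*}

/-- **Gauss lemma**: an `ε`-integral POLYNOMIAL `g ∈ F(ε)[x]` (i.e. `lim_{ε→0} g` exists in the
sense of `EpsLim`) satisfies `q(ε)·g = Ĝ` with `q(0) ≠ 0`, `Ĝ ∈ F[ε][x]`, and then
`q(0)·lim g = Ĝ(0)`. (From the tree's `exists_epsNormalForm` and "`val_ε ≥ 0`"
`IsEpsInt.exists_ord_of_normalForm`.)
[cite: DuttaDwivediSaxena2022, Claim 3.3 proof "it must happen that … ≥ 0" (full version p0027 L729–735)] -/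
theorem EpsLim.exists_integralModel {g : MvPolynomial σ (RatFunc F)}
    {r : FractionRing (MvPolynomial σ F)}
    (h : EpsLim (algebraMap (MvPolynomial σ (RatFunc F))
      (FractionRing (MvPolynomial σ (RatFunc F))) g) r) :
    ∃ (q : F[X]) (G : MvPolynomial σ F[X]), q.coeff 0 ≠ 0 ∧
      C (algebraMap F[X] (RatFunc F) q) * g = map (algebraMap F[X] (RatFunc F)) G ∧
      limToFrac F σ (C (q.coeff 0)) * r = limToFrac F σ (redZero F σ G) := by
  by_cases hg : g = 0
  · refine ⟨1, 0, by simp, by rw [hg, mul_zero, map_zero], ?_⟩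
    rw [hg, map_zero] at h
    rw [h.unique epsLim_zero, mul_zero, map_zero, map_zero]
  obtain ⟨c, G₀, hc, hgc, hG₀⟩ := exists_epsNormalForm g hg
  rw [← redZero_apply] at hG₀
  have hint : IsEpsInt (algebraMap (MvPolynomial σ (RatFunc F))
      (FractionRing (MvPolynomial σ (RatFunc F)))
        (C c * map (algebraMap F[X] (RatFunc F)) G₀)) := by
    rw [← hgc]
    exact h.isEpsInt
  obtain ⟨a, p, q, -, hq, hcq⟩ := IsEpsInt.exists_ord_of_normalForm hc hG₀ hint
  have hGq : C (algebraMap F[X] (RatFunc F) q) * g =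
      map (algebraMap F[X] (RatFunc F)) (C (Polynomial.X ^ a * p) * G₀) := by
    rw [hgc, ← mul_assoc, ← map_mul C, mul_comm _ c, hcq,
      map_mul (map (algebraMap F[X] (RatFunc F))), map_C]
  refine ⟨q, C (Polynomial.X ^ a * p) * G₀, hq, hGq, ?_⟩
  have h1 : EpsLim (algebraMap (MvPolynomial σ (RatFunc F))
      (FractionRing (MvPolynomial σ (RatFunc F)))
        (C (algebraMap F[X] (RatFunc F) q) * g))
      (limToFrac F σ (C (q.coeff 0)) * r) := by
    rw [map_mul]
    exact (epsLim_C_algebraMap q).mul h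
  have h2 : EpsLim (algebraMap (MvPolynomial σ (RatFunc F))
      (FractionRing (MvPolynomial σ (RatFunc F)))
        (C (algebraMap F[X] (RatFunc F) q) * g))
      (limToFrac F σ (redZero F σ (C (Polynomial.X ^ a * p) * G₀))) := by
    rw [hGq, redZero_apply]
    exact epsLim_algebraMap_map _
  exact h1.unique h2

/-- **Limits of polynomials are polynomials** (up to the embedding `F[x] → F(x)`).
[cite: DuttaDwivediSaxena2022, Def. 2.1 (full version p0016 L416–419)] -/
theorem EpsLim.exists_eq_limToFrac {g : MvPolynomial σ (RatFunc F)}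
    {r : FractionRing (MvPolynomial σ F)}
    (h : EpsLim (algebraMap (MvPolynomial σ (RatFunc F))
      (FractionRing (MvPolynomial σ (RatFunc F))) g) r) :
    ∃ f : MvPolynomial σ F, r = limToFrac F σ f := by
  obtain ⟨q, G, hq, -, hr⟩ := h.exists_integralModel
  refine ⟨C (q.coeff 0)⁻¹ * redZero F σ G, ?_⟩
  rw [map_mul (limToFrac F σ), ← hr, ← mul_assoc, ← map_mul (limToFrac F σ), ← C_mul,
    inv_mul_cancel₀ hq, C_1, map_one, one_mul]

/-- **Homogeneous components commute with `lim_{ε→0}`** for `ε`-integral polynomials.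
[cite: DuttaDwivediSaxena2022, Claim 3.4 proof (full version p0029 L777–779); Claim 3.8 proof (p0035 L936–941)] -/
theorem EpsLim.homogeneousComponent {g : MvPolynomial σ (RatFunc F)} {f : MvPolynomial σ F}
    (h : EpsLim (algebraMap (MvPolynomial σ (RatFunc F))
      (FractionRing (MvPolynomial σ (RatFunc F))) g) (limToFrac F σ f)) (c : ℕ) :
    EpsLim (algebraMap (MvPolynomial σ (RatFunc F)) (FractionRing (MvPolynomial σ (RatFunc F)))
        (MvPolynomial.homogeneousComponent c g))
      (limToFrac F σ (MvPolynomial.homogeneousComponent c f)) := by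
  obtain ⟨q, G, hq, hgG, hr⟩ := h.exists_integralModel
  -- `C q₀ · f = G(0)`
  rw [← map_mul (limToFrac F σ)] at hr
  have hf : C (q.coeff 0) * f = redZero F σ G := limToFrac_injective hr
  -- the component of `g` as `(C q)⁻¹ · component of Ĝ`
  have hq' : algebraMap (MvPolynomial σ (RatFunc F)) (FractionRing (MvPolynomial σ (RatFunc F)))
      (C (algebraMap F[X] (RatFunc F) q)) ≠ 0 :=
    (epsLim_C_algebraMap (F := F) (σ := σ) q).ne_zero (limToFrac_ne_zero (C_ne_zero.mpr hq))
  have key : algebraMap (MvPolynomial σ (RatFunc F)) (FractionRing (MvPolynomial σ (RatFunc F)))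
        (MvPolynomial.homogeneousComponent c g) =
      (algebraMap (MvPolynomial σ (RatFunc F)) (FractionRing (MvPolynomial σ (RatFunc F)))
          (C (algebraMap F[X] (RatFunc F) q)))⁻¹ *
        algebraMap (MvPolynomial σ (RatFunc F)) (FractionRing (MvPolynomial σ (RatFunc F)))
          (map (algebraMap F[X] (RatFunc F)) (MvPolynomial.homogeneousComponent c G)) := by
    rw [eq_inv_mul_iff_mul_eq₀ hq', ← map_mul (algebraMap (MvPolynomial σ (RatFunc F))
      (FractionRing (MvPolynomial σ (RatFunc F)))), ← homogeneousComponent_C_mul, hgG,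
      homogeneousComponent_map']
  rw [key]
  have h3 := ((epsLim_C_algebraMap (F := F) (σ := σ) q).inv
    (limToFrac_ne_zero (C_ne_zero.mpr hq))).mul
    (epsLim_algebraMap_map (F := F) (σ := σ) (MvPolynomial.homogeneousComponent c G))
  have hval : (limToFrac F σ (C (q.coeff 0)))⁻¹ *
      limToFrac F σ (map (Polynomial.constantCoeff : F[X] →+* F)
        (MvPolynomial.homogeneousComponent c G)) =
      limToFrac F σ (MvPolynomial.homogeneousComponent c f) := by
    rw [inv_mul_eq_iff_eq_mul₀ (limToFrac_ne_zero (C_ne_zero.mpr hq)), ← map_mul,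
      ← homogeneousComponent_C_mul, hf, redZero_apply, homogeneousComponent_map']
  rwa [hval] at h3

/-- **Integral models with a prescribed denominator**: if `Y` is `ε`-integral and `Y·E` is a
POLYNOMIAL `g ∈ F(ε)[x]` for an integral `E` with `E(0) ≠ 0`, then `Y = Ĝ/(q·E)` with
`q(0) ≠ 0`, `Ĝ ∈ F[ε][x]` — so every property of `E`'s initial form passes to the denominator
(used for `Y = g_j/T̃ = Σ_i T_{i,j}/T̃`, whose individual terms are NOT `ε`-integral).
[cite: DuttaDwivediSaxena2022, Claim 3.8 proof "g_j/T̃_{k−j,j} ∈ F(x,ε)[[z]]" (full version p0035 L934–936)] -/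
theorem EpsLim.exists_model_of_mul_intToFrac {Y : FractionRing (MvPolynomial σ (RatFunc F))}
    {r : FractionRing (MvPolynomial σ F)} (hY : EpsLim Y r) {E : MvPolynomial σ F[X]}
    {g : MvPolynomial σ (RatFunc F)}
    (hg : Y * intToFrac F σ E = algebraMap (MvPolynomial σ (RatFunc F))
      (FractionRing (MvPolynomial σ (RatFunc F))) g) :
    ∃ (q : F[X]) (G : MvPolynomial σ F[X]), q.coeff 0 ≠ 0 ∧
      Y * intToFrac F σ (C q * E) = intToFrac F σ G := by
  have h1 : EpsLim (algebraMap (MvPolynomial σ (RatFunc F))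
      (FractionRing (MvPolynomial σ (RatFunc F))) g) (r * limToFrac F σ (redZero F σ E)) := by
    rw [← hg]
    exact hY.mul (epsLim_intToFrac E)
  obtain ⟨q, G, hq, hgG, -⟩ := h1.exists_integralModel
  refine ⟨q, G, hq, ?_⟩
  rw [map_mul, mul_comm (intToFrac F σ (C q)), ← mul_assoc, hg, intToFrac_apply (C q), map_C,
    ← map_mul, mul_comm g, hgG, intToFrac_apply]

end Gauss

/-! ### (G4) `lim_{ε→0}` commutes with `·|_{z=0}` under an `ε`-unit initial form of the denominator -/

section LimGradeZero

variable {F : Type*} [Field F] {σ : Type*}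
variable {Y : FractionRing (MvPolynomial σ (RatFunc F))} {r : FractionRing (MvPolynomial σ F)}

/-- A model with `ε`-unit initial form has a nonzero reduction. [cite: DuttaDwivediSaxena2022, §3 DIVIDE step (full version p0030 L808–810)] -/
theorem redZero_ne_zero_of_initialForm {E : MvPolynomial σ F[X]}
    (hE : redZero F σ (initialForm E) ≠ 0) : redZero F σ E ≠ 0 := by
  intro h
  apply hE
  rw [initialForm, redZero_apply, ← homogeneousComponent_map', ← redZero_apply, h, map_zero]

/-- **`Y|_{z=0}` from an integral model**: `Y = M/E` (`M` vanishing below `λ = ldeg E`) gives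
`Y|_{z=0} = [M]_λ / in(E)` read in `F(ε)(x)`.
[cite: DuttaDwivediSaxena2022, Claim 3.8 proof (full version p0035 L934–939)] -/
theorem gradeZero_of_intModel {M E : MvPolynomial σ F[X]} (hE0 : E ≠ 0)
    (hmod : Y * intToFrac F σ E = intToFrac F σ M)
    (hM : ∀ d : σ →₀ ℕ, d.degree < ldeg E → coeff d M = 0) :
    GradeZero Y (intToFrac F σ (MvPolynomial.homogeneousComponent (ldeg E) M) /
      intToFrac F σ (initialForm E)) := by
  have hinj := RatFunc.algebraMap_injective F
  have hQ : map (algebraMap F[X] (RatFunc F)) E ≠ 0 :=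
    fun h => hE0 (map_injective _ hinj (by rw [h, map_zero]))
  have hmod' : Y * algebraMap (MvPolynomial σ (RatFunc F)) (FractionRing (MvPolynomial σ (RatFunc F)))
      (map (algebraMap F[X] (RatFunc F)) E) = algebraMap _ _ (map (algebraMap F[X] (RatFunc F)) M) := by
    rw [← intToFrac_apply, ← intToFrac_apply, hmod]
  have hvan : ∀ d : σ →₀ ℕ, d.degree < ldeg (map (algebraMap F[X] (RatFunc F)) E) →
      coeff d (map (algebraMap F[X] (RatFunc F)) M) = 0 :=
    fun d hd => coeff_map_eq_zero_of_lt _ hM d (by rwa [ldeg_map_of_injective hinj] at hd)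
  have h := gradeZero_of_model (Y := Y) hQ hmod' hvan
  rw [ldeg_map_of_injective hinj, homogeneousComponent_map', initialForm_map_of_injective hinj,
    ← intToFrac_apply, ← intToFrac_apply] at h
  exact h

/-- **`(lim Y)|_{z=0}` from an integral model with `ε`-unit initial form**: if moreover
`red(in E) ≠ 0`, then `lim Y = M(0)/E(0)` has `(lim Y)|_{z=0} = [M(0)]_λ / in(E(0))` with the SAME
`λ = ldeg E` and `in(E(0)) = (in E)(0)`.
[cite: DuttaDwivediSaxena2022, Claim 3.8 proof "valuation with respect to z and ε is non-negative" (full version p0035 L935–936)] -/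
theorem gradeZero_lim_of_intModel (hY : EpsLim Y r) {M E : MvPolynomial σ F[X]}
    (hE : redZero F σ (initialForm E) ≠ 0)
    (hmod : Y * intToFrac F σ E = intToFrac F σ M)
    (hM : ∀ d : σ →₀ ℕ, d.degree < ldeg E → coeff d M = 0) :
    GradeZero r (limToFrac F σ (MvPolynomial.homogeneousComponent (ldeg E) (redZero F σ M)) /
      limToFrac F σ (redZero F σ (initialForm E))) := by
  have hE' : redZero F σ E ≠ 0 := redZero_ne_zero_of_initialForm hE
  have hE1 : map (Polynomial.constantCoeff : F[X] →+* F) (initialForm E) ≠ 0 := by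
    rwa [← redZero_apply]
  have hl : ldeg (redZero F σ E) = ldeg E := by
    rw [redZero_apply]
    exact ldeg_map_eq_of_ne_zero _ hE1
  have hin : initialForm (redZero F σ E) = redZero F σ (initialForm E) := by
    rw [redZero_apply, redZero_apply]
    exact initialForm_map_eq_of_ne_zero _ hE1
  have hr : r * limToFrac F σ (redZero F σ E) = limToFrac F σ (redZero F σ M) :=
    hY.mul_eq_of_model hE' hmod
  have hvan : ∀ d : σ →₀ ℕ, d.degree < ldeg (redZero F σ E) → coeff d (redZero F σ M) = 0 :=
    fun d hd => by
      rw [redZero_apply]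
      exact coeff_map_eq_zero_of_lt _ hM d (by rwa [hl] at hd)
  have h := gradeZero_of_model (Y := r) (P := redZero F σ M) (Q := redZero F σ E) hE' hr hvan
  rw [hl, hin] at h
  exact h

/-- ★ **`lim_{ε→0}` COMMUTES WITH `·|_{z=0}`** under the invariant "the denominator model has an
`ε`-unit initial form" (NOTE-t21g13 (I2)): if `Y = M/E` with `M, E ∈ F[ε][x]`, `M` vanishing
below `ldeg E` and `red(in E) ≠ 0`, then `lim (Y|_{z=0}) = (lim Y)|_{z=0}`. This is the honest
content of "`f_j/t|_{z=0} = lim_{ε→0} (g_j/T̃)|_{z=0}`" (and of "`(Φ(f₀)/T̃)|_{ε=0} = Φ(f₀)/t`"); for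
a non-generic shift the hypothesis — and the conclusion — can fail (memo F4).
[cite: DuttaDwivediSaxena2022, Claim 3.8 proof (full version p0035 L934–941); Claim 3.4 proof (p0029 L777–779)] -/
theorem EpsLim.gradeZero_of_model (hY : EpsLim Y r) {M E : MvPolynomial σ F[X]}
    (hE : redZero F σ (initialForm E) ≠ 0)
    (hmod : Y * intToFrac F σ E = intToFrac F σ M)
    (hM : ∀ d : σ →₀ ℕ, d.degree < ldeg E → coeff d M = 0)
    {w : FractionRing (MvPolynomial σ (RatFunc F))} {w₀ : FractionRing (MvPolynomial σ F)}
    (hw : GradeZero Y w) (hw₀ : GradeZero r w₀) : EpsLim w w₀ := by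
  have hE0 : E ≠ 0 := fun h => hE (by rw [h, initialForm, map_zero, map_zero])
  rw [hw.unique (gradeZero_of_intModel hE0 hmod hM),
    hw₀.unique (gradeZero_lim_of_intModel hY hE hmod hM)]
  have h := epsLim_intToFrac_div (M := MvPolynomial.homogeneousComponent (ldeg E) M) hE
  have e : redZero F σ (MvPolynomial.homogeneousComponent (ldeg E) M) =
      MvPolynomial.homogeneousComponent (ldeg E) (redZero F σ M) := by
    rw [redZero_apply, redZero_apply, homogeneousComponent_map']
  rwa [e] at h

end LimGradeZero

end DDS2021

end Literature.Computability.AlgebraicComplexity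

end
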